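import Summits.QuantumFields.YangMills.Theorems.BalabanLadderUVSeamRecColdWallSplitEnergyCorner
import HarnessLib

/-!
# Crux `UVSeamRec` (stmt-QuantumFields-20043), registered line «coldwall_pure»: the cold-wall split (CW) holds for EVERY exterior on the
# whole window `R + 1 ≤ ⌈β^θ⌉`, `θ < 1/8`, by the TILT INEQUALITY — the stub `stub_coldWallSplit` reduces to its femto tail

Helper file (`--supports stmt-QuantumFields-20043`) of the LEAD seat `ym-spine-20043-p1` (gen 16); sequel of `…ColdWallSplitEnergyCorner` (g15).

THE OBSERVATION.  The classical response at tilt `s = 1` is `cr₁(η) = m₀(η) − m₁(η)` with `m₁(η) = inf_ζ [S_Λ(ζ ∨ η) − (N − plane q x (ζ ∨ η))]`, so for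
EVERY inner configuration `ζ` (not only for ground states):
`N − plane q x (ζ ∨ η) ≤ cr₁(η) + [S_Λ(ζ ∨ η) − m₀(η)]`   (`deficit_le_classicalResponse_add_excess`)
— the centre deficit is paid by the classical centre RESPONSE plus the configuration's EXCESS ENERGY over the Dirichlet minimum.  Integrating against
the cube kernel and using tempered-d1∕LEAD g11's thermal excess bound `kerE^η(S_Λ) − m₀(η) ≤ #P_Λ(38 + 12 log β)/β` (`ThermalFloor.kerE_wilsonBoundaryAction_mem_Icc`,
EVERY exterior, `β ≥ 1`):
* `kerE_deficit_le_classicalResponse_add` — `kerE^η_{β,(x−R−1,2R+3)}(2 − plane q x) ≤ cr₁(η) + 120(2R+3)⁴(38 + 12 log β)/β` for EVERY `η` (g15 had the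
  classical ENERGY `m₀(η)` in place of the RESPONSE `cr₁(η)`: `kerE_deficit_le_tiltedMin_add`);
* `abs_kerE_plane_sub_le_classicalResponse_add` — `|kerE^η(plane q x) − kerE^𝟙(plane q x)| ≤ cr₁(η) + 120(2R+3)⁴(38 + 12 log β)/β`;
* `coldWallSplit_inequality_of_slop_le` — hence the registered inequality `(R⁴/C₁)|kerE^η(plane) − kerE^𝟙(plane)| ≤ A₂ + carrierCl rF C_s 1 β R q x η`
  for EVERY exterior as soon as `C_s ≤ C₁β` (the carrier `βR⁴cr₁/C_s` dominates `R⁴cr₁/C₁`) and the thermal slop `120R⁴(2R+3)⁴(38+12 log β)/(C₁β) ≤ A₂`;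
* `coldWallSplit_window` — **(CW) FOR EVERY EXTERIOR ON THE WHOLE WINDOW `R + 1 ≤ ⌈β^θ⌉`, ANY `0 < θ < 1/8`, ANY CONSTANTS `C_s, C₁, A₂ > 0`**,
  eventually in `β` (supersedes g15's corona-good corner `coldWallSplit_coronaGood_window`, `θ ≤ 1/16`; the residual class of `coldWallSplit_of_residual`
  is EMPTY below `β^{1/8−}`);
* `coldWallSplit_of_femtoTail` — the registered stub's sentence (∃-constants, whole femto window) FOLLOWS from the same sentence restricted to the TAIL
  `⌈β^{1/9}⌉ ≤ R + 2` (reshape glue: `stub_coldWallSplit` becomes a theorem of the skeleton, the open content is `stub_coldWallSplitFemtoTail`).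
So the located open content of (CW) is EXACTLY its infrared part `β^{1/9} ≲ R ≤ ℓ₂/uRec β` (the thermal slop of the whole box, `∝ R⁴ log β/β`, against
the resolution `C₁A₂/R⁴`).  General compact `G` for the tilt inequality and its kernel form; `SU(2)` for the thermal numbers.
HONEST FRAMING: elementary (definition of the tilted minimum + a landed Laplace bound); (CW) on the tail, (GD), the floors are OPEN; nothing of E0′, NT
or the gap; YM mass gap NOT proved; not Clay.
-/

set_option autoImplicit false

noncomputable section

open MeasureTheory Finset Filter
open Literature.MathematicalPhysics.QuantumFieldTheory (LatticeRep haarProbability)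
open Literature.MathematicalPhysics.QuantumLattice (LGConfig ZdEdge plaquettesTouching fundamentalRep fundamentalLatticeRep wilsonBoundaryAction
  continuous_wilsonBoundaryAction isProbabilityMeasure_ymSpecification ymSpecification)
open Literature.Probability.LatticeModels (glueWith measurable_glueWith)
open Summit.QuantumFields.YangMills.Cruxes.OSLegsFromFemtoAndGap.DlrCollarTransfer (cubeSites cubeEdges kerE plane continuous_plane)
open Summit.QuantumFields.YangMills.Cruxes.UVSeamRec.ClassicalResponse.ThermalFloor (kerE_wilsonBoundaryAction_mem_Icc
  card_plaquettesTouching_cubeEdges_le kerE_one_deficit_le_pointwise)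
open Summit.QuantumFields.YangMills.Theorems.OSLegsFromFemtoAndGap.StubLower (integrable_of_continuous_compact)
open Summit.QuantumFields.YangMills.Theorems.WeakCouplingRates (exists_const_mul_boxSide_pow_mul_rpow_le)

namespace Summit.QuantumFields.YangMills.Cruxes.UVSeamRec.ClassicalResponse.ColdWall

/-! ### §1 The tilt inequality and its kernel form (every compact `G`) -/

section General

variable {G : Type} [Group G] [TopologicalSpace G] [IsTopologicalGroup G] [CompactSpace G] [MeasurableSpace G] [BorelSpace G]
  (r : LatticeRep G)

omit [BorelSpace G] in
/-- **The tilt inequality.**  For every cube `(c, b)`, plaquette `(x, q)`, exterior `η` and EVERY inner configuration `ζ`: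
`N − plane q x (ζ ∨ η) ≤ classicalResponse₁(η) + [S_Λ(ζ ∨ η) − m₀(η)]` (since `m₁(η) ≤ S_Λ(ζ ∨ η) − (N − plane q x (ζ ∨ η))` and
`classicalResponse₁ = m₀ − m₁`). [folklore] -/
theorem deficit_le_classicalResponse_add_excess (c : Fin 4 → ℤ) (b : ℕ) (q : Fin 4 × Fin 4) (x : Fin 4 → ℤ) (η : LGConfig 4 G)
    (ζ : ↥(cubeEdges c b) → G) :
    (r.N : ℝ) - plane G r q x (glueWith (cubeEdges c b) ζ η) ≤
      classicalResponse r c b q x 1 η +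
        (wilsonBoundaryAction r.ρ (cubeEdges c b) (glueWith (cubeEdges c b) ζ η) - tiltedMin r c b q x 0 η) := by
  have h := tiltedMin_le (r := r) c b q x 1 η ζ
  unfold tiltedAction at h
  rw [one_mul] at h
  unfold classicalResponse
  rw [div_one]
  linarith

/-- **Monotonicity of the cube kernel along the glued fibre**: if `F₁ ≤ F₂` on every configuration `ζ ∨ η` glued from an inner `ζ` and the
exterior `η`, then `kerE^η(F₁) ≤ kerE^η(F₂)` (the kernel is a tilt of the image of the fibre's Haar measure under `ζ ↦ ζ ∨ η`). [folklore] -/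
theorem kerE_mono_of_forall_glueWith (β : ℝ) (c : Fin 4 → ℤ) (b : ℕ) (η : LGConfig 4 G) {F₁ F₂ : LGConfig 4 G → ℝ}
    (hF₁ : Continuous F₁) (hF₂ : Continuous F₂)
    (h : ∀ ζ : ↥(cubeEdges c b) → G, F₁ (glueWith (cubeEdges c b) ζ η) ≤ F₂ (glueWith (cubeEdges c b) ζ η)) :
    kerE G r β c b η F₁ ≤ kerE G r β c b η F₂ := by
  haveI := r.secondCountableTopology
  haveI := isProbabilityMeasure_ymSpecification r.ρ r.continuous β (cubeEdges c b) η
  unfold kerE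
  refine integral_mono_ae (integrable_of_continuous_compact hF₁) (integrable_of_continuous_compact hF₂) ?_
  have hν : ∀ᵐ U ∂((Measure.pi fun _ : ↥(cubeEdges c b) => haarProbability G).map (glueWith (cubeEdges c b) · η)),
      F₁ U ≤ F₂ U := by
    rw [ae_map_iff (measurable_glueWith (cubeEdges c b) η).aemeasurable (measurableSet_le hF₁.measurable hF₂.measurable)]
    exact ae_of_all _ h
  exact (tilted_absolutelyContinuous _ _).ae_le hν

/-- **Kernel form of the tilt inequality** (every compact `G`, every cube, every exterior):
`kerE^η(N − plane q x) ≤ classicalResponse₁(η) + [kerE^η(S_Λ) − m₀(η)]` — the quantum centre deficit is paid by the classical centre response plus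
the MEAN EXCESS ENERGY of the box over its Dirichlet minimum. [folklore] -/
theorem kerE_deficit_le_classicalResponse_add_excess (β : ℝ) (c : Fin 4 → ℤ) (b : ℕ) (q : Fin 4 × Fin 4) (x : Fin 4 → ℤ)
    (η : LGConfig 4 G) :
    kerE G r β c b η (fun U => (r.N : ℝ) - plane G r q x U) ≤
      classicalResponse r c b q x 1 η + (kerE G r β c b η (wilsonBoundaryAction r.ρ (cubeEdges c b)) - tiltedMin r c b q x 0 η) := by
  haveI := r.secondCountableTopology
  haveI := isProbabilityMeasure_ymSpecification r.ρ r.continuous β (cubeEdges c b) η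
  have hS : Continuous (wilsonBoundaryAction r.ρ (cubeEdges c b) : LGConfig 4 G → ℝ) :=
    continuous_wilsonBoundaryAction r.ρ r.continuous _
  have hmono := kerE_mono_of_forall_glueWith r β c b η (F₁ := fun U => (r.N : ℝ) - plane G r q x U)
    (F₂ := fun U => wilsonBoundaryAction r.ρ (cubeEdges c b) U + (classicalResponse r c b q x 1 η - tiltedMin r c b q x 0 η))
    (continuous_const.sub (continuous_plane r q x)) (hS.add continuous_const)
    (fun ζ => by linarith [deficit_le_classicalResponse_add_excess r c b q x η ζ])
  have hadd : kerE G r β c b η (fun U => wilsonBoundaryAction r.ρ (cubeEdges c b) U +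
      (classicalResponse r c b q x 1 η - tiltedMin r c b q x 0 η)) =
      kerE G r β c b η (wilsonBoundaryAction r.ρ (cubeEdges c b)) + (classicalResponse r c b q x 1 η - tiltedMin r c b q x 0 η) := by
    unfold kerE
    rw [integral_add (integrable_of_continuous_compact hS) (integrable_const _), integral_const, smul_eq_mul, probReal_univ, one_mul]
  rw [hadd] at hmono
  linarith

end General

/-! ### §2 `SU(2)`: the centre deficit, and the response to the exterior, are paid by the classical RESPONSE plus the thermal slop -/

/-- **The centre deficit is at most the classical RESPONSE plus the thermal excess** (`SU(2)`, every cube `(x − R − 1, 2R+3)`, `β ≥ 1`, every plane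
`q`, EVERY exterior `η`): `kerE^η(2 − plane q x) ≤ classicalResponse₁(η) + 120(2R+3)⁴(38 + 12 log β)/β`. [folklore] -/
theorem kerE_deficit_le_classicalResponse_add {β : ℝ} (hβ : 1 ≤ β) (R : ℕ) (q : Fin 4 × Fin 4) (x : Fin 4 → ℤ)
    (η : LGConfig 4 (Matrix.specialUnitaryGroup (Fin 2) ℂ)) :
    kerE (Matrix.specialUnitaryGroup (Fin 2) ℂ) (fundamentalLatticeRep 2) β (fun k => x k - (R + 1)) (2 * R + 3) η
        (fun U => 2 - plane (Matrix.specialUnitaryGroup (Fin 2) ℂ) (fundamentalLatticeRep 2) q x U) ≤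
      classicalResponse (fundamentalLatticeRep 2) (fun k => x k - (R + 1)) (2 * R + 3) q x 1 η +
        120 * ((2 * R + 3 : ℕ) : ℝ) ^ 4 * ((38 + 12 * Real.log β) / β) := by
  -- the kernel form of the tilt inequality, read with `N = 2` and `ρ = fundamentalRep (Fin 2)` (definitional unfoldings of `fundamentalLatticeRep 2`)
  have h1 : kerE (Matrix.specialUnitaryGroup (Fin 2) ℂ) (fundamentalLatticeRep 2) β (fun k => x k - (R + 1)) (2 * R + 3) η
        (fun U => 2 - plane (Matrix.specialUnitaryGroup (Fin 2) ℂ) (fundamentalLatticeRep 2) q x U) ≤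
      classicalResponse (fundamentalLatticeRep 2) (fun k => x k - (R + 1)) (2 * R + 3) q x 1 η +
        (kerE (Matrix.specialUnitaryGroup (Fin 2) ℂ) (fundamentalLatticeRep 2) β (fun k => x k - (R + 1)) (2 * R + 3) η
          (wilsonBoundaryAction (fundamentalRep (Fin 2)) (cubeEdges (fun k => x k - ((R : ℤ) + 1)) (2 * R + 3))) -
          tiltedMin (fundamentalLatticeRep 2) (fun k => x k - (R + 1)) (2 * R + 3) q x 0 η) := by
    have h := kerE_deficit_le_classicalResponse_add_excess (fundamentalLatticeRep 2) β (fun k => x k - ((R : ℤ) + 1)) (2 * R + 3) q x η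
    have hN : ((fundamentalLatticeRep 2).N : ℝ) = 2 := by simp
    simp only [hN] at h
    exact h
  have h2 := (kerE_wilsonBoundaryAction_mem_Icc (fun k => x k - ((R : ℤ) + 1)) (2 * R + 3) q x η hβ).2
  have h3 : ((plaquettesTouching (cubeEdges (fun k => x k - ((R : ℤ) + 1)) (2 * R + 3))).card : ℝ) ≤ 120 * ((2 * R + 3 : ℕ) : ℝ) ^ 4 := by
    exact_mod_cast card_plaquettesTouching_cubeEdges_le (fun k => x k - ((R : ℤ) + 1)) (2 * R + 3)
  have hβ0 : 0 < β := by linarith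
  have hpos : 0 ≤ (38 + 12 * Real.log β) / β := div_nonneg (by linarith [Real.log_nonneg hβ]) hβ0.le
  have h4 := mul_le_mul_of_nonneg_right h3 hpos
  linarith [h1, h2, h4]

/-- **THE RESPONSE TO THE EXTERIOR IS AT MOST THE CLASSICAL CENTRE RESPONSE PLUS THE THERMAL SLOP.**  For `β ≥ 1`, every cube `(x − R − 1, 2R+3)`,
plane `q.1 < q.2` and EVERY exterior `η`: `|kerE^η(plane q x) − kerE^𝟙(plane q x)| ≤ classicalResponse₁(η) + 120(2R+3)⁴(38 + 12 log β)/β` (both centre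
deficits are non-negative; the cold-wall one is `≤ 120(2R+3)⁴(34 + 6 log β)/β`, `kerE_one_deficit_le_pointwise`). [folklore] -/
theorem abs_kerE_plane_sub_le_classicalResponse_add {β : ℝ} (hβ : 1 ≤ β) (R : ℕ) (q : Fin 4 × Fin 4) (hq : q.1 < q.2) (x : Fin 4 → ℤ)
    (η : LGConfig 4 (Matrix.specialUnitaryGroup (Fin 2) ℂ)) :
    |kerE (Matrix.specialUnitaryGroup (Fin 2) ℂ) (fundamentalLatticeRep 2) β (fun k => x k - (R + 1)) (2 * R + 3) η
          (plane (Matrix.specialUnitaryGroup (Fin 2) ℂ) (fundamentalLatticeRep 2) q x) -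
        kerE (Matrix.specialUnitaryGroup (Fin 2) ℂ) (fundamentalLatticeRep 2) β (fun k => x k - (R + 1)) (2 * R + 3) 1
          (plane (Matrix.specialUnitaryGroup (Fin 2) ℂ) (fundamentalLatticeRep 2) q x)| ≤
      classicalResponse (fundamentalLatticeRep 2) (fun k => x k - (R + 1)) (2 * R + 3) q x 1 η +
        120 * ((2 * R + 3 : ℕ) : ℝ) ^ 4 * ((38 + 12 * Real.log β) / β) := by
  have hN : ((fundamentalLatticeRep 2).N : ℝ) = 2 := by simp
  have hd := kerE_deficit_le_classicalResponse_add hβ R q x η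
  have hd0 := (kerE_deficit_mem_Icc (r := fundamentalLatticeRep 2) β (fun k => x k - ((R : ℤ) + 1)) (2 * R + 3) η q x).1
  have h1 : kerE (Matrix.specialUnitaryGroup (Fin 2) ℂ) (fundamentalLatticeRep 2) β (fun k => x k - (R + 1)) (2 * R + 3) 1
        (fun U => 2 - plane (Matrix.specialUnitaryGroup (Fin 2) ℂ) (fundamentalLatticeRep 2) q x U) ≤
      120 * ((2 * R + 3 : ℕ) : ℝ) ^ 4 * ((34 + 6 * Real.log β) / β) := kerE_one_deficit_le_pointwise hβ R q hq x
  have h10 := (kerE_deficit_mem_Icc (r := fundamentalLatticeRep 2) β (fun k => x k - ((R : ℤ) + 1)) (2 * R + 3)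
    (1 : LGConfig 4 (Matrix.specialUnitaryGroup (Fin 2) ℂ)) q x).1
  simp only [hN] at hd0 h10
  rw [kerE_const_sub (r := fundamentalLatticeRep 2) β _ _ η (continuous_plane (fundamentalLatticeRep 2) q x) 2] at hd hd0
  rw [kerE_const_sub (r := fundamentalLatticeRep 2) β _ _ (1 : LGConfig 4 (Matrix.specialUnitaryGroup (Fin 2) ℂ))
    (continuous_plane (fundamentalLatticeRep 2) q x) 2] at h1 h10
  have hcr : 0 ≤ classicalResponse (fundamentalLatticeRep 2) (fun k => x k - ((R : ℤ) + 1)) (2 * R + 3) q x 1 η :=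
    classicalResponse_nonneg _ _ q x one_pos η
  have hβ0 : 0 < β := by linarith
  have hlog : (34 + 6 * Real.log β) / β ≤ (38 + 12 * Real.log β) / β :=
    div_le_div_of_nonneg_right (by linarith [Real.log_nonneg hβ]) hβ0.le
  have hS : 0 ≤ 120 * ((2 * R + 3 : ℕ) : ℝ) ^ 4 := by positivity
  have h1' := h1.trans (mul_le_mul_of_nonneg_left hlog hS)
  rw [abs_le]
  constructor <;> nlinarith [hd, hd0, h1', h10, hcr]

/-- **(CW) AT `(β, R)` FOR EVERY EXTERIOR, given two numerical side conditions**: `β ≥ 1`, `C_s ≤ C₁β` (the carrier `βR⁴·cr₁/C_s` dominates `R⁴·cr₁/C₁`)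
and the thermal slop below the tolerance, `(R⁴/C₁)·120(2R+3)⁴(38 + 12 log β)/β ≤ A₂`.  Then for every plane `q.1 < q.2`, site `x` and EVERY exterior
`η`: `(R⁴/C₁)|kerE^η(plane q x) − kerE^𝟙(plane q x)| ≤ A₂ + carrierCl rF C_s 1 β R q x η`. [folklore] -/
theorem coldWallSplit_inequality_of_slop_le {β : ℝ} (hβ : 1 ≤ β) {C_s C₁ A₂ : ℝ} (hCs : 0 < C_s) (hC₁ : 0 < C₁) (hCβ : C_s ≤ C₁ * β)
    (R : ℕ) (hslop : (R : ℝ) ^ 4 / C₁ * (120 * ((2 * R + 3 : ℕ) : ℝ) ^ 4 * ((38 + 12 * Real.log β) / β)) ≤ A₂)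
    (q : Fin 4 × Fin 4) (hq : q.1 < q.2) (x : Fin 4 → ℤ) (η : LGConfig 4 (Matrix.specialUnitaryGroup (Fin 2) ℂ)) :
    (R : ℝ) ^ 4 / C₁ * |kerE (Matrix.specialUnitaryGroup (Fin 2) ℂ) (fundamentalLatticeRep 2) β (fun k => x k - (R + 1)) (2 * R + 3) η
          (plane (Matrix.specialUnitaryGroup (Fin 2) ℂ) (fundamentalLatticeRep 2) q x) -
        kerE (Matrix.specialUnitaryGroup (Fin 2) ℂ) (fundamentalLatticeRep 2) β (fun k => x k - (R + 1)) (2 * R + 3) 1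
          (plane (Matrix.specialUnitaryGroup (Fin 2) ℂ) (fundamentalLatticeRep 2) q x)| ≤
      A₂ + carrierCl (fundamentalLatticeRep 2) C_s 1 β R q x η := by
  have h := abs_kerE_plane_sub_le_classicalResponse_add hβ R q hq x η
  have hR : 0 ≤ (R : ℝ) ^ 4 / C₁ := by positivity
  have hβ0 : 0 < β := by linarith
  set cr := classicalResponse (fundamentalLatticeRep 2) (fun k => x k - ((R : ℤ) + 1)) (2 * R + 3) q x 1 η with hcrdef
  have hcr : 0 ≤ cr := classicalResponse_nonneg _ _ q x one_pos η
  -- the carrier dominates `(R⁴/C₁)·cr`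
  have hcar : (R : ℝ) ^ 4 / C₁ * cr ≤ carrierCl (fundamentalLatticeRep 2) C_s 1 β R q x η := by
    unfold carrierCl
    rw [← hcrdef]
    have hcoef : (R : ℝ) ^ 4 / C₁ ≤ β * (R : ℝ) ^ 4 / C_s := by
      rw [div_le_div_iff₀ hC₁ hCs]
      have hR4 : 0 ≤ (R : ℝ) ^ 4 := by positivity
      nlinarith [mul_le_mul_of_nonneg_left hCβ hR4]
    exact mul_le_mul_of_nonneg_right hcoef hcr
  calc (R : ℝ) ^ 4 / C₁ * |kerE (Matrix.specialUnitaryGroup (Fin 2) ℂ) (fundamentalLatticeRep 2) β (fun k => x k - (R + 1)) (2 * R + 3) η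
          (plane (Matrix.specialUnitaryGroup (Fin 2) ℂ) (fundamentalLatticeRep 2) q x) -
        kerE (Matrix.specialUnitaryGroup (Fin 2) ℂ) (fundamentalLatticeRep 2) β (fun k => x k - (R + 1)) (2 * R + 3) 1
          (plane (Matrix.specialUnitaryGroup (Fin 2) ℂ) (fundamentalLatticeRep 2) q x)|
      ≤ (R : ℝ) ^ 4 / C₁ * (cr + 120 * ((2 * R + 3 : ℕ) : ℝ) ^ 4 * ((38 + 12 * Real.log β) / β)) := mul_le_mul_of_nonneg_left h hR
    _ = (R : ℝ) ^ 4 / C₁ * cr + (R : ℝ) ^ 4 / C₁ * (120 * ((2 * R + 3 : ℕ) : ℝ) ^ 4 * ((38 + 12 * Real.log β) / β)) := by ring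
    _ ≤ carrierCl (fundamentalLatticeRep 2) C_s 1 β R q x η + A₂ := add_le_add hcar hslop
    _ = A₂ + carrierCl (fundamentalLatticeRep 2) C_s 1 β R q x η := add_comm _ _

/-! ### §3 (CW) for every exterior on the whole window `R + 1 ≤ ⌈β^θ⌉`, `θ < 1/8` -/

/-- `(38 + 12 log β)/β ≤ (38 + 12/ε)·β^{ε − 1}` for `β ≥ 1`, `ε > 0` (`log β ≤ β^ε/ε`). [folklore] -/
theorem thermal_ratio_le_rpow {β ε : ℝ} (hβ : 1 ≤ β) (hε : 0 < ε) :
    (38 + 12 * Real.log β) / β ≤ (38 + 12 / ε) * β ^ (ε - 1) := by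
  have hβ0 : 0 < β := by linarith
  have h1 : Real.log β ≤ β ^ ε / ε := Real.log_le_rpow_div hβ0.le hε
  have h2 : 1 ≤ β ^ ε := Real.one_le_rpow hβ hε.le
  have h3 : β ^ (ε - 1) = β ^ ε / β := Real.rpow_sub_one hβ0.ne' ε
  rw [h3, ← mul_div_assoc, div_le_div_iff_of_pos_right hβ0]
  have h4 : 12 * Real.log β ≤ 12 / ε * β ^ ε := by
    have := mul_le_mul_of_nonneg_left h1 (by norm_num : (0 : ℝ) ≤ 12)
    calc 12 * Real.log β ≤ 12 * (β ^ ε / ε) := this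
      _ = 12 / ε * β ^ ε := by ring
  nlinarith [h2, h4, hε]

/-- **(CW) FOR EVERY EXTERIOR ON THE WHOLE WINDOW `R + 1 ≤ ⌈β^θ⌉`, `0 < θ < 1/8`, ANY CONSTANTS.**  For `C_s, C₁, A₂ > 0` there is `β₂ ≥ 1` such that for
all `β ≥ β₂`, all `R` with `R + 1 ≤ ⌈β^θ⌉`, every plane `q.1 < q.2`, site `x` and EVERY exterior `η`:
`(R⁴/C₁)·|kerE^η_{β,(x−R−1,2R+3)}(plane q x) − kerE^𝟙(plane q x)| ≤ A₂ + carrierCl rF C_s 1 β R q x η`.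
(`R⁴(2R+3)⁴ ≤ (2⌈β^θ⌉+3)⁸`, `(38+12 log β)/β ≤ (38 + 12/ε)β^{ε−1}` with `ε = (1 − 8θ)/2`, and `8θ + ε − 1 < 0`.)  No expansion, no rarity, no
corona condition: the whole polynomial window of the line — and every `θ < 1/8` — is settled for (CW). [folklore] -/
theorem coldWallSplit_window {θ : ℝ} (hθ : 0 < θ) (hθ₈ : θ < 1 / 8) {C_s C₁ A₂ : ℝ} (hCs : 0 < C_s) (hC₁ : 0 < C₁) (hA₂ : 0 < A₂) :
    ∃ β₂ : ℝ, 1 ≤ β₂ ∧ ∀ β : ℝ, β₂ ≤ β → ∀ R : ℕ, R + 1 ≤ ⌈β ^ θ⌉₊ → ∀ (q : Fin 4 × Fin 4) (x : Fin 4 → ℤ), q.1 < q.2 →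
      ∀ η : LGConfig 4 (Matrix.specialUnitaryGroup (Fin 2) ℂ),
        (R : ℝ) ^ 4 / C₁ * |kerE (Matrix.specialUnitaryGroup (Fin 2) ℂ) (fundamentalLatticeRep 2) β (fun k => x k - (R + 1)) (2 * R + 3) η
              (plane (Matrix.specialUnitaryGroup (Fin 2) ℂ) (fundamentalLatticeRep 2) q x) -
            kerE (Matrix.specialUnitaryGroup (Fin 2) ℂ) (fundamentalLatticeRep 2) β (fun k => x k - (R + 1)) (2 * R + 3) 1
              (plane (Matrix.specialUnitaryGroup (Fin 2) ℂ) (fundamentalLatticeRep 2) q x)| ≤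
          A₂ + carrierCl (fundamentalLatticeRep 2) C_s 1 β R q x η := by
  set ε : ℝ := (1 - 8 * θ) / 2 with hεdef
  have hε : 0 < ε := by rw [hεdef]; linarith
  -- thermal slop: `(120(38 + 12/ε)/(C₁A₂))·(2⌈β^θ⌉+3)⁸·β^{ε−1} ≤ β⁰ = 1` eventually
  obtain ⟨b₁, hb₁1, E1⟩ := exists_const_mul_boxSide_pow_mul_rpow_le (120 * (38 + 12 / ε) / (C₁ * A₂)) 8 (θ := θ) (a := ε - 1) (b := 0) hθ
    (by rw [hεdef]; push_cast; linarith)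
  refine ⟨max b₁ (C_s / C₁), hb₁1.trans (le_max_left _ _), fun β hβ R hR q x hq η => ?_⟩
  have hb1 : b₁ ≤ β := (le_max_left _ _).trans hβ
  have hβ1 : 1 ≤ β := hb₁1.trans hb1
  have hβ0 : 0 < β := by linarith
  have hCβ : C_s ≤ C₁ * β := by
    have := (le_max_right _ _).trans hβ
    rwa [div_le_iff₀' hC₁] at this
  refine coldWallSplit_inequality_of_slop_le hβ1 hCs hC₁ hCβ R ?_ q hq x η
  -- the slop bound on the window
  set S : ℝ := 2 * (⌈β ^ θ⌉₊ : ℝ) + 3 with hSdef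
  have hRS : (R : ℝ) ≤ S := by
    have h : (R : ℝ) + 1 ≤ (⌈β ^ θ⌉₊ : ℝ) := by exact_mod_cast hR
    rw [hSdef]; linarith [(Nat.cast_nonneg R : (0 : ℝ) ≤ R)]
  have hbS : ((2 * R + 3 : ℕ) : ℝ) ≤ S := by
    have h : (R : ℝ) + 1 ≤ (⌈β ^ θ⌉₊ : ℝ) := by exact_mod_cast hR
    rw [hSdef]; push_cast; linarith
  have hR4 : (R : ℝ) ^ 4 * ((2 * R + 3 : ℕ) : ℝ) ^ 4 ≤ S ^ 8 := by
    rw [show S ^ 8 = S ^ 4 * S ^ 4 by ring]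
    exact mul_le_mul (pow_le_pow_left₀ (Nat.cast_nonneg R) hRS 4) (pow_le_pow_left₀ (Nat.cast_nonneg _) hbS 4) (by positivity)
      (by positivity)
  have hlog := thermal_ratio_le_rpow (ε := ε) hβ1 hε
  have e1 := E1 β hb1
  rw [Real.rpow_zero] at e1
  have hK : 0 ≤ 38 + 12 / ε := by positivity
  have hpow0 : 0 ≤ β ^ (ε - 1) := Real.rpow_nonneg hβ0.le _
  -- `(R⁴/C₁)·120(2R+3)⁴·(38+12 log β)/β ≤ (120/C₁)·S⁸·(38+12/ε)β^{ε−1} ≤ A₂`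
  have step1 : (R : ℝ) ^ 4 / C₁ * (120 * ((2 * R + 3 : ℕ) : ℝ) ^ 4 * ((38 + 12 * Real.log β) / β)) ≤
      120 / C₁ * S ^ 8 * ((38 + 12 / ε) * β ^ (ε - 1)) := by
    have hT0 : 0 ≤ (38 + 12 * Real.log β) / β := div_nonneg (by linarith [Real.log_nonneg hβ1]) hβ0.le
    calc (R : ℝ) ^ 4 / C₁ * (120 * ((2 * R + 3 : ℕ) : ℝ) ^ 4 * ((38 + 12 * Real.log β) / β))
        = 120 / C₁ * ((R : ℝ) ^ 4 * ((2 * R + 3 : ℕ) : ℝ) ^ 4) * ((38 + 12 * Real.log β) / β) := by ring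
      _ ≤ 120 / C₁ * S ^ 8 * ((38 + 12 * Real.log β) / β) := by gcongr
      _ ≤ 120 / C₁ * S ^ 8 * ((38 + 12 / ε) * β ^ (ε - 1)) := by gcongr
  have step2 : 120 / C₁ * S ^ 8 * ((38 + 12 / ε) * β ^ (ε - 1)) = A₂ * (120 * (38 + 12 / ε) / (C₁ * A₂) * S ^ 8 * β ^ (ε - 1)) := by
    field_simp
  rw [step2] at step1
  calc _ ≤ A₂ * (120 * (38 + 12 / ε) / (C₁ * A₂) * S ^ 8 * β ^ (ε - 1)) := step1
    _ ≤ A₂ * 1 := mul_le_mul_of_nonneg_left e1 hA₂.le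
    _ = A₂ := mul_one _

/-! ### §4 Reshape glue: the registered stub's sentence follows from its femto TAIL -/

/-- **`stub_coldWallSplit` ⟸ ITS FEMTO TAIL.**  If the sentence of the registered stub (CW) holds on the TAIL window `⌈β^{1/9}⌉ ≤ R + 2 ∧ R·uRec β ≤ ℓ₂`
(its own ∃-constants), then it holds on the whole femto window `1 ≤ R ∧ R·uRec β ≤ ℓ₂` (with `A₂ ↦ A₂ + 1` and a larger onset): below the tail,
`R + 1 ≤ ⌈β^{1/9}⌉` and §3 applies with `θ = 1/9 < 1/8`. [folklore] -/
theorem coldWallSplit_of_femtoTail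
    (htail : ∃ (C_s C₁ A₂ β₂ ℓ₂ : ℝ), 0 < C_s ∧ 0 < C₁ ∧ 0 ≤ A₂ ∧ 0 < ℓ₂ ∧
      ∀ β : ℝ, β₂ ≤ β → ∀ R : ℕ, 1 ≤ R → ⌈β ^ (1 / 9 : ℝ)⌉₊ ≤ R + 2 → (R : ℝ) * Transport.uRec β ≤ ℓ₂ →
      ∀ (q : Fin 4 × Fin 4) (x : Fin 4 → ℤ), q.1 < q.2 → ∀ η : LGConfig 4 (Matrix.specialUnitaryGroup (Fin 2) ℂ),
      (R : ℝ) ^ 4 / C₁ * |kerE (Matrix.specialUnitaryGroup (Fin 2) ℂ) (fundamentalLatticeRep 2) β (fun k => x k - (R + 1)) (2 * R + 3) η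
          (plane (Matrix.specialUnitaryGroup (Fin 2) ℂ) (fundamentalLatticeRep 2) q x) -
        kerE (Matrix.specialUnitaryGroup (Fin 2) ℂ) (fundamentalLatticeRep 2) β (fun k => x k - (R + 1)) (2 * R + 3) 1
          (plane (Matrix.specialUnitaryGroup (Fin 2) ℂ) (fundamentalLatticeRep 2) q x)| ≤
        A₂ + carrierCl (fundamentalLatticeRep 2) C_s 1 β R q x η) :
    ∃ (C_s C₁ A₂ β₂ ℓ₂ : ℝ), 0 < C_s ∧ 0 < C₁ ∧ 0 ≤ A₂ ∧ 0 < ℓ₂ ∧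
      ∀ β : ℝ, β₂ ≤ β → ∀ R : ℕ, 1 ≤ R → (R : ℝ) * Transport.uRec β ≤ ℓ₂ →
      ∀ (q : Fin 4 × Fin 4) (x : Fin 4 → ℤ), q.1 < q.2 → ∀ η : LGConfig 4 (Matrix.specialUnitaryGroup (Fin 2) ℂ),
      (R : ℝ) ^ 4 / C₁ * |kerE (Matrix.specialUnitaryGroup (Fin 2) ℂ) (fundamentalLatticeRep 2) β (fun k => x k - (R + 1)) (2 * R + 3) η
          (plane (Matrix.specialUnitaryGroup (Fin 2) ℂ) (fundamentalLatticeRep 2) q x) -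
        kerE (Matrix.specialUnitaryGroup (Fin 2) ℂ) (fundamentalLatticeRep 2) β (fun k => x k - (R + 1)) (2 * R + 3) 1
          (plane (Matrix.specialUnitaryGroup (Fin 2) ℂ) (fundamentalLatticeRep 2) q x)| ≤
        A₂ + carrierCl (fundamentalLatticeRep 2) C_s 1 β R q x η := by
  obtain ⟨C_s, C₁, A₂, β₂, ℓ₂, hCs, hC₁, hA₂, hℓ₂, htail⟩ := htail
  obtain ⟨βw, -, hw⟩ := coldWallSplit_window (θ := 1 / 9) (by norm_num) (by norm_num) hCs hC₁ (show 0 < A₂ + 1 by linarith)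
  refine ⟨C_s, C₁, A₂ + 1, max β₂ βw, ℓ₂, hCs, hC₁, by linarith, hℓ₂, fun β hβ R hR hRu q x hq η => ?_⟩
  by_cases htl : ⌈β ^ (1 / 9 : ℝ)⌉₊ ≤ R + 2
  · have h := htail β ((le_max_left _ _).trans hβ) R hR htl hRu q x hq η
    linarith
  · push Not at htl
    exact hw β ((le_max_right _ _).trans hβ) R (by omega) q x hq η

/-! ### §5 The sibling line «classical_dominance»: its split (SD) with `A = 1` on the same window -/

/-- **The thermal slop of the whole box is below any fixed tolerance on the window `R + 1 ≤ ⌈β^θ⌉`, `θ < 1/8`**: for `K > 0` there is `β₀ ≥ 1` with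
`R⁴·120(2R+3)⁴(38 + 12 log β)/β ≤ K` for all `β ≥ β₀` and `R + 1 ≤ ⌈β^θ⌉` (`R⁴(2R+3)⁴ ≤ (2⌈β^θ⌉+3)⁸`, `(38+12 log β)/β ≤ (38+12/ε)β^{ε−1}`, `ε = (1−8θ)/2`).
[folklore] -/
theorem slop_le_of_window {θ : ℝ} (hθ : 0 < θ) (hθ₈ : θ < 1 / 8) {K : ℝ} (hK : 0 < K) :
    ∃ β₀ : ℝ, 1 ≤ β₀ ∧ ∀ β : ℝ, β₀ ≤ β → ∀ R : ℕ, R + 1 ≤ ⌈β ^ θ⌉₊ →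
      (R : ℝ) ^ 4 * (120 * ((2 * R + 3 : ℕ) : ℝ) ^ 4 * ((38 + 12 * Real.log β) / β)) ≤ K := by
  set ε : ℝ := (1 - 8 * θ) / 2 with hεdef
  have hε : 0 < ε := by rw [hεdef]; linarith
  obtain ⟨b₁, hb₁1, E1⟩ := exists_const_mul_boxSide_pow_mul_rpow_le (120 * (38 + 12 / ε) / K) 8 (θ := θ) (a := ε - 1) (b := 0) hθ
    (by rw [hεdef]; push_cast; linarith)
  refine ⟨b₁, hb₁1, fun β hβ R hR => ?_⟩
  have hβ1 : 1 ≤ β := hb₁1.trans hβ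
  have hβ0 : 0 < β := by linarith
  set S : ℝ := 2 * (⌈β ^ θ⌉₊ : ℝ) + 3 with hSdef
  have hRS : (R : ℝ) ≤ S := by
    have h : (R : ℝ) + 1 ≤ (⌈β ^ θ⌉₊ : ℝ) := by exact_mod_cast hR
    rw [hSdef]; linarith [(Nat.cast_nonneg R : (0 : ℝ) ≤ R)]
  have hbS : ((2 * R + 3 : ℕ) : ℝ) ≤ S := by
    have h : (R : ℝ) + 1 ≤ (⌈β ^ θ⌉₊ : ℝ) := by exact_mod_cast hR
    rw [hSdef]; push_cast; linarith
  have hR4 : (R : ℝ) ^ 4 * ((2 * R + 3 : ℕ) : ℝ) ^ 4 ≤ S ^ 8 := by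
    rw [show S ^ 8 = S ^ 4 * S ^ 4 by ring]
    exact mul_le_mul (pow_le_pow_left₀ (Nat.cast_nonneg R) hRS 4) (pow_le_pow_left₀ (Nat.cast_nonneg _) hbS 4) (by positivity)
      (by positivity)
  have hlog := thermal_ratio_le_rpow (ε := ε) hβ1 hε
  have e1 := E1 β hβ
  rw [Real.rpow_zero] at e1
  have hKε : 0 ≤ 38 + 12 / ε := by positivity
  have step1 : (R : ℝ) ^ 4 * (120 * ((2 * R + 3 : ℕ) : ℝ) ^ 4 * ((38 + 12 * Real.log β) / β)) ≤
      120 * S ^ 8 * ((38 + 12 / ε) * β ^ (ε - 1)) := by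
    have hT0 : 0 ≤ (38 + 12 * Real.log β) / β := div_nonneg (by linarith [Real.log_nonneg hβ1]) hβ0.le
    calc (R : ℝ) ^ 4 * (120 * ((2 * R + 3 : ℕ) : ℝ) ^ 4 * ((38 + 12 * Real.log β) / β))
        = 120 * ((R : ℝ) ^ 4 * ((2 * R + 3 : ℕ) : ℝ) ^ 4) * ((38 + 12 * Real.log β) / β) := by ring
      _ ≤ 120 * S ^ 8 * ((38 + 12 * Real.log β) / β) := by gcongr
      _ ≤ 120 * S ^ 8 * ((38 + 12 / ε) * β ^ (ε - 1)) := by gcongr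
  have step2 : 120 * S ^ 8 * ((38 + 12 / ε) * β ^ (ε - 1)) = K * (120 * (38 + 12 / ε) / K * S ^ 8 * β ^ (ε - 1)) := by
    field_simp
  rw [step2] at step1
  calc _ ≤ K * (120 * (38 + 12 / ε) / K * S ^ 8 * β ^ (ε - 1)) := step1
    _ ≤ K * 1 := mul_le_mul_of_nonneg_left e1 hK.le
    _ = K := mul_one _

/-- **THE SIBLING LINE'S SPLIT (SD) WITH `A = 1` ON THE WINDOW `R + 1 ≤ ⌈β^θ⌉`, `θ < 1/8`** (ym-idea-10's «classical_dominance», `stub_classicalDominance`: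
`|kerE^η(plane q x) − kerE^𝟙(plane q x)| ≤ A·classicalResponse₁(η) + κ/R⁴`, response units, no `β`-lever): for every `κ > 0` there is `β₀ ≥ 1` such that
for all `β ≥ β₀`, `1 ≤ R`, `R + 1 ≤ ⌈β^θ⌉`, every plane `q.1 < q.2`, site `x` and EVERY exterior `η` the inequality holds with `A = 1`
(`abs_kerE_plane_sub_le_classicalResponse_add` + `slop_le_of_window`).  Its femto tail is that line's open content, exactly as for (CW). [folklore] -/
theorem classicalDominance_window {θ : ℝ} (hθ : 0 < θ) (hθ₈ : θ < 1 / 8) {κ : ℝ} (hκ : 0 < κ) :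
    ∃ β₀ : ℝ, 1 ≤ β₀ ∧ ∀ β : ℝ, β₀ ≤ β → ∀ R : ℕ, 1 ≤ R → R + 1 ≤ ⌈β ^ θ⌉₊ → ∀ (q : Fin 4 × Fin 4) (x : Fin 4 → ℤ), q.1 < q.2 →
      ∀ η : LGConfig 4 (Matrix.specialUnitaryGroup (Fin 2) ℂ),
        |kerE (Matrix.specialUnitaryGroup (Fin 2) ℂ) (fundamentalLatticeRep 2) β (fun k => x k - (R + 1)) (2 * R + 3) η
            (plane (Matrix.specialUnitaryGroup (Fin 2) ℂ) (fundamentalLatticeRep 2) q x) -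
          kerE (Matrix.specialUnitaryGroup (Fin 2) ℂ) (fundamentalLatticeRep 2) β (fun k => x k - (R + 1)) (2 * R + 3) 1
            (plane (Matrix.specialUnitaryGroup (Fin 2) ℂ) (fundamentalLatticeRep 2) q x)| ≤
          1 * classicalResponse (fundamentalLatticeRep 2) (fun k => x k - (R + 1)) (2 * R + 3) q x 1 η + κ / (R : ℝ) ^ 4 := by
  obtain ⟨β₀, hβ₀1, hslop⟩ := slop_le_of_window hθ hθ₈ hκ
  refine ⟨β₀, hβ₀1, fun β hβ R hR1 hR q x hq η => ?_⟩
  have hβ1 : 1 ≤ β := hβ₀1.trans hβ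
  have h := abs_kerE_plane_sub_le_classicalResponse_add hβ1 R q hq x η
  have hs := hslop β hβ R hR
  have hR0 : (0 : ℝ) < (R : ℝ) ^ 4 := by
    have : (0 : ℝ) < R := by exact_mod_cast (show 0 < R by omega)
    positivity
  -- `slop ≤ κ/R⁴`
  have hs' : 120 * ((2 * R + 3 : ℕ) : ℝ) ^ 4 * ((38 + 12 * Real.log β) / β) ≤ κ / (R : ℝ) ^ 4 := by
    rw [le_div_iff₀ hR0, mul_comm]
    exact hs
  rw [one_mul]
  linarith

end Summit.QuantumFields.YangMills.Cruxes.UVSeamRec.ClassicalResponse.ColdWall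

end
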